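import Mathlib
import Literature.NumberTheory.Transcendental.KZHyperbolicLadder
import Summits.KontsevichZagierPeriods.KontsevichZagierPeriods.Theorems.HyperbolicBlochOffTetraSectorKernelRungZeroIntervals

/-!
# `OffTetraSectorKernel` (stmt-KontsevichZagierPeriods-10557), line `odd-hyperbolic-ladder`:
# volume injectivity at rung `0`

Stub `volumeInjectivity_zero`: the `n = 0` instance of the line's named input
`stub_volumeInjectivity n` (a `ℤ`-relation among hyperbolic volumes of `ℚ̄`-geodesic polytopes of
`ℍⁿ⁺¹` is, up to a positive integer multiple, a scissors relation). Rung `0` is the hyperbolic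
LINE `{t > 0} ⊆ ℝ¹` with the length density `dt/t`; by `isGeodesicPolytope_zero_eq_interval` its
polytopes are the intervals `{α < t < β}` with real-algebraic end points `0 < α ≤ β`, of length
`log (β/α)`. We prove, with multiple `M = 1` and no transcendence input, that every relation
`Σ mᵢ log (βᵢ/αᵢ) = 0` is generated by dissections and `ℚ̄`-dilations:

* exponentiating, the relation is the EXACT multiplicative relation `∏ qᵢ^{mᵢ⁺} = ∏ qᵢ^{mᵢ⁻}`
  (`qᵢ = βᵢ/αᵢ ≥ 1`, `mᵢ = mᵢ⁺ − mᵢ⁻`);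
* the dilation `t ↦ c t` (`c > 0` real-algebraic) is the boundary similarity of `ℍ¹` (trivial
  boundary part), so `[{α<t<β}] − [{cα<t<cβ}]` is a congruence relator, and `[{α<t<β}] ∼
  [{1<t<β/α}] =: L (β/α)`;
* cutting `(1, q q')` at `q` (a dissection relator: the defect is the null point `{t = q}`) and
  dilating `(1, q')` onto `(q, q q')` gives `L (q q') − L q − L q'` a relation, and `L 1 = [∅]` is a
  relation (the degenerate dissection `[∅] − [∅] − [∅]`);
* hence `L (∏ qᵢ^{eᵢ}) − Σ eᵢ • L qᵢ` is a relation, and the exact relation finishes.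

The multiplicative bookkeeping is done abstractly, for any map `L : ℝ → G` into an abelian group
which is multiplicative modulo a subgroup `S` on real-algebraic numbers `≥ 1`.

References: A. B. Goncharov, *Volumes of hyperbolic manifolds and mixed Tate motives* (1999),
§1.7; J. L. Dupont, C.-H. Sah, *Scissors congruences II* (1982), §2; R. Benedetti, C. Petronio,
*Lectures on Hyperbolic Geometry* (1992), A.3.5.
-/

noncomputable section

open Set MeasureTheory
open Literature.NumberTheory.Transcendental

namespace Summit.KontsevichZagierPeriods.HyperbolicBloch.OffTetraSectorKernel

/-! ### Intervals of the hyperbolic line: length, polytope structure, the two relators -/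

/-- The hyperbolic length of the interval `{α < t < β}` (`0 < α ≤ β`) of `ℍ¹` is `log (β/α)`:
`∫_α^β dt/t`. [cite: BenedettiPetronio1992, A.3] -/
theorem rungZero_setIntegral_hypDensity_interval {α β : ℝ} (hα : 0 < α) (hαβ : α ≤ β) :
    ∫ p in {p : Fin 1 → ℝ | α < p 0 ∧ p 0 < β}, KZ.hypDensity 0 p = Real.log (β / α) := by
  rw [rungZero_hypDensity_eq]
  have hset : {p : Fin 1 → ℝ | α < p 0 ∧ p 0 < β} = {p | p 0 ∈ Ioo α β} := rfl
  -- adapted from `rungZero_integrableOn_hypDensity_iff` (transport along `(Fin 1 → ℝ) ≃ᵐ ℝ`)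
  have h1 : ∫ p in {p : Fin 1 → ℝ | p 0 ∈ Ioo α β}, (p 0)⁻¹ = ∫ t in Ioo α β, t⁻¹ :=
    (volume_preserving_funUnique (Fin 1) ℝ).setIntegral_preimage_emb
      (MeasurableEquiv.funUnique (Fin 1) ℝ).measurableEmbedding (fun t => t⁻¹) (Ioo α β)
  rw [hset, h1, ← integral_Ioc_eq_integral_Ioo, ← intervalIntegral.integral_of_le hαβ,
    integral_inv_of_pos hα (hα.trans_le hαβ)]

/-- The interval `{α < t < β}` with real-algebraic end points `0 < α ≤ β` is a `ℚ̄`-geodesic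
polytope of rung `0`: it is cut out of `{t > 0}` by the two "hemispheres" `t² > α²`, `t² < β²`
centred at the boundary point `0`, and `dt/t` is integrable on it. [cite: Goncharov1999, §1.1] -/
theorem rungZero_isGeodesicPolytope_interval {α β : ℝ} (hα : 0 < α) (hαβ : α ≤ β)
    (halgα : IsAlgebraic ℚ α) (halgβ : IsAlgebraic ℚ β) :
    KZ.IsGeodesicPolytope 0 {p : Fin 1 → ℝ | α < p 0 ∧ p 0 < β} := by
  have hβ : 0 ≤ β := hα.le.trans hαβ
  refine ⟨2, fun _ => false, 0, ![α ^ 2, β ^ 2], ![1, -1], fun _ _ => isAlgebraic_zero, ?_, ?_,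
    fun _ => rfl, ?_, ?_⟩
  · intro i
    fin_cases i
    · simpa using halgα.pow 2
    · simpa using halgβ.pow 2
  · intro i
    fin_cases i <;> simp
  · ext p
    simp only [mem_setOf_eq, Fin.last_zero, Fin.forall_fin_two, Fin.sum_univ_succ,
      Fin.sum_univ_zero, add_zero, Pi.zero_apply, sub_zero, Matrix.cons_val_zero,
      Matrix.cons_val_one, Bool.false_eq_true, if_false, one_mul, neg_mul, neg_sub, sub_pos]
    constructor
    · rintro ⟨h1, h2⟩
      have hp : 0 < p 0 := hα.trans h1
      exact ⟨hp, (pow_lt_pow_iff_left₀ hα.le hp.le two_ne_zero).2 h1,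
        (pow_lt_pow_iff_left₀ hp.le hβ two_ne_zero).2 h2⟩
    · rintro ⟨hp, h1, h2⟩
      exact ⟨(pow_lt_pow_iff_left₀ hα.le hp.le two_ne_zero).1 h1,
        (pow_lt_pow_iff_left₀ hp.le hβ two_ne_zero).1 h2⟩
  · have hc : ContinuousOn (fun t : ℝ => t⁻¹) (Icc α β) :=
      continuousOn_id.inv₀ fun t ht => (hα.trans_le ht.1).ne'
    exact (rungZero_integrableOn_hypDensity_iff (Ioo α β)).2
      ((hc.integrableOn_compact isCompact_Icc).mono_set Ioo_subset_Icc_self)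

/-- At rung `0` the boundary similarity `(x, t) ↦ (c A x + b, c t)` is the dilation `t ↦ c t`
(the boundary `ℝ⁰` is a point). [cite: BenedettiPetronio1992, A.3.5] -/
theorem rungZero_boundarySimilarity_apply (c : ℝ) (A : Matrix (Fin 0) (Fin 0) ℝ) (b : Fin 0 → ℝ)
    (p : Fin 1 → ℝ) : KZ.boundarySimilarity 0 c A b p = fun _ => c * p 0 := by
  ext i
  obtain rfl : i = Fin.last 0 := Subsingleton.elim (α := Fin 1) _ _
  simp [KZ.boundarySimilarity]

/-- **Dilation relator.** For real-algebraic `c > 0` and an interval `{α < t < β}` of `ℍ¹` with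
real-algebraic `0 < α ≤ β`, `[{cα < t < cβ}] − [{α < t < β}]` is a scissors relator of rung `0`
(congruence by the boundary similarity `t ↦ c t`). [cite: DupontSah1982, §2] -/
theorem rungZero_of_dilate_sub_of_mem {α β c : ℝ} (hα : 0 < α) (hαβ : α ≤ β)
    (halgα : IsAlgebraic ℚ α) (halgβ : IsAlgebraic ℚ β) (hc : 0 < c) (halgc : IsAlgebraic ℚ c) :
    FreeAbelianGroup.of {p : Fin 1 → ℝ | c * α < p 0 ∧ p 0 < c * β} -
      FreeAbelianGroup.of {p : Fin 1 → ℝ | α < p 0 ∧ p 0 < β} ∈ KZ.scissorsRelations 0 := by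
  refine AddSubgroup.subset_closure (Or.inr ⟨_, _, c, 1, 0,
    rungZero_isGeodesicPolytope_interval hα hαβ halgα halgβ,
    rungZero_isGeodesicPolytope_interval (mul_pos hc hα) (mul_le_mul_of_nonneg_left hαβ hc.le)
      (halgc.mul halgα) (halgc.mul halgβ),
    halgc, hc, fun i => i.elim0, by simp, fun i => i.elim0, ?_, rfl⟩)
  ext p
  simp only [mem_setOf_eq, mem_image, rungZero_boundarySimilarity_apply]
  constructor
  · rintro ⟨h1, h2⟩
    refine ⟨fun _ => p 0 / c, ⟨?_, ?_⟩, ?_⟩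
    · rw [lt_div_iff₀ hc]; linarith
    · rw [div_lt_iff₀ hc]; linarith
    · ext i
      obtain rfl : i = 0 := Subsingleton.elim (α := Fin 1) _ _
      field_simp
  · rintro ⟨q, ⟨h1, h2⟩, rfl⟩
    exact ⟨mul_lt_mul_of_pos_left h1 hc, mul_lt_mul_of_pos_left h2 hc⟩

/-- **Dissection relator.** Cutting the interval `{α < t < γ}` of `ℍ¹` (real-algebraic
`0 < α ≤ β ≤ γ`) at `β`: `[{α<t<γ}] − [{α<t<β}] − [{β<t<γ}]` is a scissors relator of rung `0`
(the two pieces are disjoint and the defect is the null point `{t = β}`).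
[cite: DupontSah1982, §2] -/
theorem rungZero_of_sub_of_sub_of_mem {α β γ : ℝ} (hα : 0 < α) (hαβ : α ≤ β) (hβγ : β ≤ γ)
    (halgα : IsAlgebraic ℚ α) (halgβ : IsAlgebraic ℚ β) (halgγ : IsAlgebraic ℚ γ) :
    FreeAbelianGroup.of {p : Fin 1 → ℝ | α < p 0 ∧ p 0 < γ} -
      FreeAbelianGroup.of {p : Fin 1 → ℝ | α < p 0 ∧ p 0 < β} -
      FreeAbelianGroup.of {p : Fin 1 → ℝ | β < p 0 ∧ p 0 < γ} ∈ KZ.scissorsRelations 0 := by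
  refine AddSubgroup.subset_closure (Or.inl (Or.inl ⟨_, _, _,
    rungZero_isGeodesicPolytope_interval hα (hαβ.trans hβγ) halgα halgγ,
    rungZero_isGeodesicPolytope_interval hα hαβ halgα halgβ,
    rungZero_isGeodesicPolytope_interval (hα.trans_le hαβ) hβγ halgβ halgγ,
    fun p hp => ⟨hp.1, hp.2.trans_le hβγ⟩, fun p hp => ⟨hαβ.trans_lt hp.1, hp.2⟩, ?_, ?_, rfl⟩))
  · have h : {p : Fin 1 → ℝ | α < p 0 ∧ p 0 < β} ∩ {p : Fin 1 → ℝ | β < p 0 ∧ p 0 < γ} = ∅ := by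
      ext p
      simp only [mem_inter_iff, mem_setOf_eq, mem_empty_iff_false, iff_false, not_and, not_lt,
        and_imp]
      intro _ h2 h3
      linarith
    rw [h, measure_empty]
  · -- the defect is contained in the null point `{t = β}` of `ℝ¹`
    have hnull : volume {p : Fin 1 → ℝ | p 0 = β} = 0 := by
      rw [volume_pi]
      exact Measure.pi_hyperplane _ _ _
    refine measure_mono_null (fun p hp => ?_) hnull
    simp only [mem_sdiff, mem_setOf_eq, mem_union, not_or, not_and, not_lt] at hp
    obtain ⟨⟨h1, h2⟩, h3, h4⟩ := hp
    show p 0 = β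
    rcases (h3 h1).lt_or_eq with h5 | h5
    · exact absurd h2 (not_lt.2 (h4 h5))
    · exact h5.symm

/-- The empty interval `{1 < t < 1} = ∅` is a scissors relation of rung `0` (the degenerate
dissection relator `[∅] − [∅] − [∅] = −[∅]`). [cite: DupontSah1982, §2] -/
theorem rungZero_of_interval_one_one_mem :
    FreeAbelianGroup.of {p : Fin 1 → ℝ | 1 < p 0 ∧ p 0 < 1} ∈ KZ.scissorsRelations 0 := by
  have hE := rungZero_isGeodesicPolytope_interval one_pos le_rfl isAlgebraic_one isAlgebraic_one
  have hE0 : {p : Fin 1 → ℝ | 1 < p 0 ∧ p 0 < 1} = ∅ := by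
    ext p
    simp only [mem_setOf_eq, mem_empty_iff_false, iff_false, not_and, not_lt]
    exact fun h => h.le
  have h : FreeAbelianGroup.of {p : Fin 1 → ℝ | 1 < p 0 ∧ p 0 < 1} -
      FreeAbelianGroup.of {p : Fin 1 → ℝ | 1 < p 0 ∧ p 0 < 1} -
      FreeAbelianGroup.of {p : Fin 1 → ℝ | 1 < p 0 ∧ p 0 < 1} ∈ KZ.scissorsRelations 0 :=
    AddSubgroup.subset_closure (Or.inl (Or.inl ⟨_, _, _, hE, hE, hE, Subset.rfl, Subset.rfl,
      by rw [hE0, empty_inter, measure_empty], by rw [hE0, empty_sdiff, measure_empty], rfl⟩))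
  have h' := (KZ.scissorsRelations 0).neg_mem h
  convert h' using 1
  abel

/-- **Multiplicativity of `q ↦ L q = [{1 < t < q}]` modulo scissors relations**: for
real-algebraic `q, q' ≥ 1`, `L (q q') − L q − L q'` is a scissors relation of rung `0` (dissect
`(1, q q')` at `q`, then dilate `(1, q')` by `q` onto `(q, q q')`). [cite: Goncharov1999, §1.7] -/
theorem rungZero_of_interval_mul_sub_sub_mem {q q' : ℝ} (h1q : 1 ≤ q) (h1q' : 1 ≤ q')
    (hq : IsAlgebraic ℚ q) (hq' : IsAlgebraic ℚ q') :
    FreeAbelianGroup.of {p : Fin 1 → ℝ | 1 < p 0 ∧ p 0 < q * q'} -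
      FreeAbelianGroup.of {p : Fin 1 → ℝ | 1 < p 0 ∧ p 0 < q} -
      FreeAbelianGroup.of {p : Fin 1 → ℝ | 1 < p 0 ∧ p 0 < q'} ∈ KZ.scissorsRelations 0 := by
  have hq0 : 0 < q := one_pos.trans_le h1q
  have hsplit := rungZero_of_sub_of_sub_of_mem (β := q) (γ := q * q') one_pos h1q
    (le_mul_of_one_le_right hq0.le h1q') isAlgebraic_one hq (hq.mul hq')
  have hdil := rungZero_of_dilate_sub_of_mem (α := 1) (β := q') (c := q) one_pos h1q'
    isAlgebraic_one hq' hq0 hq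
  rw [mul_one] at hdil
  have h := (KZ.scissorsRelations 0).add_mem hsplit hdil
  convert h using 1
  abel

/-! ### Abstract multiplicative bookkeeping -/

section Bookkeeping

variable {G : Type*} [AddCommGroup G] {S : AddSubgroup G} {L : ℝ → G}

/-- If `L : ℝ → G` is multiplicative modulo `S` on real-algebraic numbers `≥ 1` and `L 1 ∈ S`,
then `L (q ^ e) − e • L q ∈ S`. [folklore] -/
theorem logBook_pow_sub_mem (hone : L 1 ∈ S)
    (hmul : ∀ q q' : ℝ, 1 ≤ q → 1 ≤ q' → IsAlgebraic ℚ q → IsAlgebraic ℚ q' →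
      L (q * q') - L q - L q' ∈ S)
    {q : ℝ} (h1q : 1 ≤ q) (hq : IsAlgebraic ℚ q) (e : ℕ) : L (q ^ e) - e • L q ∈ S := by
  induction e with
  | zero =>
    rw [pow_zero, zero_smul, sub_zero]
    exact hone
  | succ e ih =>
    have h := S.add_mem (hmul _ _ (one_le_pow₀ h1q) h1q (hq.pow e) hq) ih
    rw [pow_succ, succ_nsmul]
    convert h using 1
    abel

/-- If `L : ℝ → G` is multiplicative modulo `S` on real-algebraic numbers `≥ 1` and `L 1 ∈ S`,
then `L (∏ qᵢ ^ eᵢ) − Σ eᵢ • L qᵢ ∈ S` for real-algebraic `qᵢ ≥ 1`. [folklore] -/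
theorem logBook_prod_pow_sub_sum_mem (hone : L 1 ∈ S)
    (hmul : ∀ q q' : ℝ, 1 ≤ q → 1 ≤ q' → IsAlgebraic ℚ q → IsAlgebraic ℚ q' →
      L (q * q') - L q - L q' ∈ S)
    {ι : Type*} (s : Finset ι) {q : ι → ℝ} (e : ι → ℕ)
    (h1q : ∀ i ∈ s, 1 ≤ q i) (hq : ∀ i ∈ s, IsAlgebraic ℚ (q i)) :
    L (∏ i ∈ s, q i ^ e i) - ∑ i ∈ s, e i • L (q i) ∈ S := by
  classical
  induction s using Finset.induction_on with
  | empty =>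
    rw [Finset.prod_empty, Finset.sum_empty, sub_zero]
    exact hone
  | insert a s ha ih =>
    have h1 : 1 ≤ q a := h1q a (Finset.mem_insert_self a s)
    have hqa : IsAlgebraic ℚ (q a) := hq a (Finset.mem_insert_self a s)
    have h1' : ∀ i ∈ s, 1 ≤ q i := fun i hi => h1q i (Finset.mem_insert_of_mem hi)
    have hq' : ∀ i ∈ s, IsAlgebraic ℚ (q i) := fun i hi => hq i (Finset.mem_insert_of_mem hi)
    have hP1 : 1 ≤ ∏ i ∈ s, q i ^ e i := Finset.one_le_prod fun i hi => one_le_pow₀ (h1' i hi)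
    have hPalg : IsAlgebraic ℚ (∏ i ∈ s, q i ^ e i) :=
      isAlgebraic_iff_isIntegral.2
        (IsIntegral.prod _ fun i hi => isAlgebraic_iff_isIntegral.1 ((hq' i hi).pow _))
    rw [Finset.prod_insert ha, Finset.sum_insert ha]
    have hm := hmul (q a ^ e a) (∏ i ∈ s, q i ^ e i) (one_le_pow₀ h1) hP1 (hqa.pow (e a)) hPalg
    have hpow := logBook_pow_sub_mem hone hmul h1 hqa (e a)
    have h := S.add_mem (S.add_mem hm hpow) (ih h1' hq')
    convert h using 1
    abel

/-- **Exact multiplicative relations are bookkeeping relations.** If `L : ℝ → G` is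
multiplicative modulo `S` on real-algebraic numbers `≥ 1` (`L 1 ∈ S`), then every `ℤ`-relation
`Σ mᵢ log qᵢ = 0` among logarithms of real-algebraic `qᵢ ≥ 1` gives `Σ mᵢ • L qᵢ ∈ S`:
exponentiating, `∏ qᵢ^{mᵢ⁺} = ∏ qᵢ^{mᵢ⁻}` EXACTLY, and both sides unfold to `Σ mᵢ^± • L qᵢ`
modulo `S`. [cite: Goncharov1999, §1.7] -/
theorem logBook_zsmul_sum_mem (hone : L 1 ∈ S)
    (hmul : ∀ q q' : ℝ, 1 ≤ q → 1 ≤ q' → IsAlgebraic ℚ q → IsAlgebraic ℚ q' →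
      L (q * q') - L q - L q' ∈ S)
    {ι : Type*} [Fintype ι] {q : ι → ℝ} (m : ι → ℤ) (h1q : ∀ i, 1 ≤ q i)
    (hq : ∀ i, IsAlgebraic ℚ (q i)) (hlog : ∑ i, (m i : ℝ) * Real.log (q i) = 0) :
    ∑ i, m i • L (q i) ∈ S := by
  -- adapted from `interval_log_relation_mem_relations` (…RungZeroLogRelations.lean)
  have hq0 : ∀ i, 0 < q i := fun i => one_pos.trans_le (h1q i)
  -- (0) the exact multiplicative relation `∏ qᵢ ^ mᵢ⁺ = ∏ qᵢ ^ mᵢ⁻`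
  have hm : ∀ i, (m i : ℝ) = ((m i).toNat : ℝ) - ((-m i).toNat : ℝ) := fun i => by
    have h := congrArg (fun z : ℤ => (z : ℝ)) (Int.toNat_sub_toNat_neg (m i))
    simp only [Int.cast_sub, Int.cast_natCast] at h
    exact h.symm
  have hlog' : ∑ i, ((m i).toNat : ℝ) * Real.log (q i) =
      ∑ i, ((-m i).toNat : ℝ) * Real.log (q i) := by
    rw [← sub_eq_zero, ← Finset.sum_sub_distrib, ← hlog]
    refine Finset.sum_congr rfl fun i _ => ?_
    rw [← sub_mul, hm i]
  have hprod : ∏ i, q i ^ (m i).toNat = ∏ i, q i ^ (-m i).toNat := by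
    have h : Real.log (∏ i, q i ^ (m i).toNat) = Real.log (∏ i, q i ^ (-m i).toNat) := by
      rw [Real.log_prod fun i _ => (pow_pos (hq0 i) _).ne',
        Real.log_prod fun i _ => (pow_pos (hq0 i) _).ne']
      simp only [Real.log_pow]
      exact hlog'
    exact Real.log_injOn_pos (Set.mem_Ioi.2 (Finset.prod_pos fun i _ => pow_pos (hq0 i) _))
      (Set.mem_Ioi.2 (Finset.prod_pos fun i _ => pow_pos (hq0 i) _)) h
  -- (1) bookkeeping on both sides
  have hp : L (∏ i, q i ^ (m i).toNat) - ∑ i, (m i).toNat • L (q i) ∈ S :=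
    logBook_prod_pow_sub_sum_mem hone hmul Finset.univ (fun i => (m i).toNat) (fun i _ => h1q i)
      (fun i _ => hq i)
  have hn : L (∏ i, q i ^ (-m i).toNat) - ∑ i, (-m i).toNat • L (q i) ∈ S :=
    logBook_prod_pow_sub_sum_mem hone hmul Finset.univ (fun i => (-m i).toNat) (fun i _ => h1q i)
      (fun i _ => hq i)
  rw [hprod] at hp
  have h := S.sub_mem hn hp
  have e : ∑ i, m i • L (q i) =
      ∑ i, (m i).toNat • L (q i) - ∑ i, (-m i).toNat • L (q i) := by
    rw [← Finset.sum_sub_distrib]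
    refine Finset.sum_congr rfl fun i _ => ?_
    calc m i • L (q i)
        = (((m i).toNat : ℤ) - ((-m i).toNat : ℤ)) • L (q i) := by rw [Int.toNat_sub_toNat_neg]
      _ = _ := by rw [sub_zsmul, natCast_zsmul, natCast_zsmul, ← sub_eq_add_neg]
  rw [e]
  convert h using 1
  abel

end Bookkeeping

/-! ### Rung `0` closes: intervals, then polytopes -/

/-- **Log-relations among `ℚ̄`-intervals of `ℍ¹` are scissors relations.** For intervals
`{αᵢ < t < βᵢ}` with real-algebraic `0 < αᵢ ≤ βᵢ`, a `ℤ`-relation `Σ mᵢ log (βᵢ/αᵢ) = 0` among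
their hyperbolic lengths makes `Σ mᵢ • [{αᵢ < t < βᵢ}]` a scissors relation of rung `0`
(dilate each interval onto `{1 < t < βᵢ/αᵢ}` and use the multiplicative bookkeeping).
[cite: Goncharov1999, §1.7] -/
theorem interval_log_relation_mem_scissorsRelations (k : ℕ) (α β : Fin k → ℝ) (m : Fin k → ℤ)
    (hα : ∀ i, 0 < α i) (hαβ : ∀ i, α i ≤ β i) (halgα : ∀ i, IsAlgebraic ℚ (α i))
    (halgβ : ∀ i, IsAlgebraic ℚ (β i)) (hlog : ∑ i, (m i : ℝ) * Real.log (β i / α i) = 0) :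
    ∑ i, m i • FreeAbelianGroup.of {p : Fin 1 → ℝ | α i < p 0 ∧ p 0 < β i} ∈
      KZ.scissorsRelations 0 := by
  have hq1 : ∀ i, 1 ≤ β i / α i := fun i => (one_le_div (hα i)).2 (hαβ i)
  have hqalg : ∀ i, IsAlgebraic ℚ (β i / α i) := fun i => (halgβ i).mul (halgα i).inv
  -- (1) bookkeeping: `Σ mᵢ • L (βᵢ/αᵢ) ∈ S` for `L q = [{1 < t < q}]`
  have hLsum : ∑ i, m i • FreeAbelianGroup.of {p : Fin 1 → ℝ | 1 < p 0 ∧ p 0 < β i / α i} ∈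
      KZ.scissorsRelations 0 :=
    logBook_zsmul_sum_mem (S := KZ.scissorsRelations 0)
      (L := fun q : ℝ => FreeAbelianGroup.of {p : Fin 1 → ℝ | 1 < p 0 ∧ p 0 < q})
      rungZero_of_interval_one_one_mem
      (fun q q' h1q h1q' hq hq' => rungZero_of_interval_mul_sub_sub_mem h1q h1q' hq hq')
      m hq1 hqalg hlog
  -- (2) transport: `[{αᵢ < t < βᵢ}] − L (βᵢ/αᵢ) ∈ S` by the dilation `t ↦ t / αᵢ`
  have hT : ∀ i, FreeAbelianGroup.of {p : Fin 1 → ℝ | α i < p 0 ∧ p 0 < β i} -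
      FreeAbelianGroup.of {p : Fin 1 → ℝ | 1 < p 0 ∧ p 0 < β i / α i} ∈
        KZ.scissorsRelations 0 := fun i => by
    have h := rungZero_of_dilate_sub_of_mem (hα i) (hαβ i) (halgα i) (halgβ i)
      (inv_pos.2 (hα i)) (halgα i).inv
    rw [inv_mul_cancel₀ (hα i).ne', ← div_eq_inv_mul] at h
    have h' := (KZ.scissorsRelations 0).neg_mem h
    rwa [neg_sub] at h'
  have e : ∑ i, m i • FreeAbelianGroup.of {p : Fin 1 → ℝ | α i < p 0 ∧ p 0 < β i} =
      ∑ i, m i • (FreeAbelianGroup.of {p : Fin 1 → ℝ | α i < p 0 ∧ p 0 < β i} -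
        FreeAbelianGroup.of {p : Fin 1 → ℝ | 1 < p 0 ∧ p 0 < β i / α i}) +
      ∑ i, m i • FreeAbelianGroup.of {p : Fin 1 → ℝ | 1 < p 0 ∧ p 0 < β i / α i} := by
    rw [← Finset.sum_add_distrib]
    refine Finset.sum_congr rfl fun i _ => ?_
    rw [zsmul_sub, sub_add_cancel]
  rw [e]
  exact (KZ.scissorsRelations 0).add_mem
    (sum_mem fun i _ => (KZ.scissorsRelations 0).zsmul_mem (hT i) _) hLsum

/-- **Volume injectivity at rung `0` (`stub_volumeInjectivity 0`, with `M = 1`).** On the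
hyperbolic line, a `ℤ`-relation `Σ mᵢ vol (Pᵢ) = 0` among hyperbolic lengths of `ℚ̄`-geodesic
polytopes (intervals `{αᵢ < t < βᵢ}`, lengths `log (βᵢ/αᵢ)`) is a scissors relation: it is
generated by dissections and `ℚ̄`-dilations. [cite: Goncharov1999, §1.7] -/
theorem volumeInjectivity_zero : ∀ (k : ℕ) (P : Fin k → Set (Fin (0 + 1) → ℝ)) (m : Fin k → ℤ), (∀ i, Literature.NumberTheory.Transcendental.KZ.IsGeodesicPolytope 0 (P i)) → ∑ i, (m i : ℝ) * (∫ p in P i, Literature.NumberTheory.Transcendental.KZ.hypDensity 0 p) = 0 → ∃ M : ℕ, 0 < M ∧ M • ∑ i, m i • FreeAbelianGroup.of (P i) ∈ Literature.NumberTheory.Transcendental.KZ.scissorsRelations 0 := by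
  intro k P m hP hsum
  choose α β hα hαβ halgα halgβ hPe using fun i => isGeodesicPolytope_zero_eq_interval (P i) (hP i)
  have hval : ∀ i, ∫ p in P i, KZ.hypDensity 0 p = Real.log (β i / α i) := fun i => by
    rw [hPe i]
    exact rungZero_setIntegral_hypDensity_interval (hα i) (hαβ i)
  simp only [hval] at hsum
  refine ⟨1, one_pos, ?_⟩
  rw [one_smul]
  have hP' : P = fun i => {p : Fin 1 → ℝ | α i < p 0 ∧ p 0 < β i} := funext hPe
  subst hP'
  exact interval_log_relation_mem_scissorsRelations k α β m hα hαβ halgα halgβ hsum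

end Summit.KontsevichZagierPeriods.HyperbolicBloch.OffTetraSectorKernel

end
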